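import Summits.AtomisticToContinuum.BoseEinsteinCondensation.Theses.BECTangentRigidity
import Mathlib

/-!
# AtomisticToContinuum / BoseEinsteinCondensation — route BECTangentRigidity, item `CoarsePigeonhole`

Settles the support item `stmt-AtomisticToContinuum-13036` of route
`route-AtomisticToContinuum-BECTangentRigidity`:

`CoarsePigeonhole : CoarseCoherence-hypothesis → BoseEinsteinCondensation`.

Coarse coherence at a FIXED dyadic level `K` — eventually in `N`, for some `δ > 0`, every
`δ`-near-minimiser `Ψ` of the Dirichlet `N`-body energy in the box of side `L = (N/ρ)^{1/3}` has
`∑_Q ⟨φ_Q, γ_Ψ φ_Q⟩ ≥ N/2`, the sum running over the `(2^K)^3 = 8^K` half-open cells `Q` of side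
`s = L/2^K` and `φ_Q = s^{-3/2}·1_Q` their flat modes — implies ground-state BEC with the
(ineffective) constant `c = (2·8^K)⁻¹`:

* pigeonhole over the finite index type `Fin 3 → Fin (2^K)` (a maximal cell occupation `occ_{m₀}`
  satisfies `∑_m occ_m ≤ 8^K · occ_{m₀}`, so `ofReal (c N) ≤ occ_{m₀}`);
* the flat cell mode is a.e.-strongly measurable and `L²`-normalised (`|Q| = s³`, computed by
  transporting Lebesgue measure on `EuclideanSpace ℝ (Fin 3)` to the product measure);
* `occupation_le_maxOccupation` and `le_condensateNumber`
  (`Literature/MathematicalPhysics/QuantumManyBody/BoseEinsteinCondensation.lean`) turn the uniform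
  bound over near-minimisers into `ofReal (c N) ≤ condensateNumber v N L`.

This is the level-`K` analogue of `AtomisticToContinuum.BECInfraredBound.bec_of_zeroMode`
(`Theorems/BECInfraredBoundAssembly.lean`, the case `K = 0`). Sources: Lieb–Seiringer–Solovej–
Yngvason 2005, §1.2 (1.17)–(1.19); Penrose–Onsager 1956 (density-matrix criterion).
-/

noncomputable section

namespace Summit.AtomisticToContinuum.BoseEinsteinCondensation.Theorems

open MeasureTheory ENNReal Filter Literature.MathematicalPhysics.QuantumManyBody.BoseGas WithLp

namespace CoarsePigeonhole

/-- The half-open coordinate cell `{x | ∀ j, x_j ∈ [a_j s, (a_j + 1) s)} ⊂ ℝ³` of side `s` with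
lower corner `s·a` is measurable (finite intersection of coordinate slabs). [folklore] -/
theorem measurableSet_cell (a : Fin 3 → ℝ) (s : ℝ) :
    MeasurableSet {x : EuclideanSpace ℝ (Fin 3) | ∀ j, x j ∈ Set.Ico (a j * s) ((a j + 1) * s)} := by
  have h : {x : EuclideanSpace ℝ (Fin 3) | ∀ j, x j ∈ Set.Ico (a j * s) ((a j + 1) * s)}
      = ⋂ j : Fin 3, (fun x : EuclideanSpace ℝ (Fin 3) => x j) ⁻¹'
          Set.Ico (a j * s) ((a j + 1) * s) := by
    ext x; simp
  rw [h]
  exact MeasurableSet.iInter fun j => measurableSet_Ico.preimage (by fun_prop)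

/-- The cell `{x | ∀ j, x_j ∈ [a_j s, (a_j + 1) s)}` of side `s ≥ 0` has Lebesgue measure `s³`
(Lebesgue measure on `EuclideanSpace ℝ (Fin 3)` is the product measure transported by
`WithLp.ofLp`). [folklore] -/
theorem volume_cell (a : Fin 3 → ℝ) (s : ℝ) :
    volume {x : EuclideanSpace ℝ (Fin 3) | ∀ j, x j ∈ Set.Ico (a j * s) ((a j + 1) * s)}
      = ENNReal.ofReal s ^ 3 := by
  have h : {x : EuclideanSpace ℝ (Fin 3) | ∀ j, x j ∈ Set.Ico (a j * s) ((a j + 1) * s)}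
      = (@ofLp 2 (Fin 3 → ℝ)) ⁻¹' (Set.univ.pi fun j => Set.Ico (a j * s) ((a j + 1) * s)) := by
    ext x; simp
  rw [h, (PiLp.volume_preserving_ofLp (Fin 3)).measure_preimage
    (MeasurableSet.univ_pi fun _ => measurableSet_Ico).nullMeasurableSet, volume_pi_pi]
  have hs : ∀ j : Fin 3, (a j + 1) * s - a j * s = s := fun j => by ring
  simp only [Real.volume_Ico, hs, Finset.prod_const, Finset.card_univ, Fintype.card_fin]

/-- The flat cell mode `φ_Q = s^{-3/2}·1_Q` is a.e.-strongly measurable (indicator of a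
measurable set). [folklore] -/
theorem aestronglyMeasurable_cellMode (a : Fin 3 → ℝ) (s : ℝ) :
    AEStronglyMeasurable
      ({x : EuclideanSpace ℝ (Fin 3) | ∀ j, x j ∈ Set.Ico (a j * s) ((a j + 1) * s)}.indicator
        (fun _ => ((Real.sqrt (s ^ 3))⁻¹ : ℂ))) volume :=
  aestronglyMeasurable_const.indicator (measurableSet_cell a s)

/-- The flat cell mode `φ_Q = s^{-3/2}·1_Q` is `L²`-normalised for `s > 0`:
`∫ |φ_Q|² = s⁻³ · |Q| = 1`. [folklore] -/
theorem lintegral_cellMode_sq (a : Fin 3 → ℝ) {s : ℝ} (hs : 0 < s) :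
    ∫⁻ x, (‖{x : EuclideanSpace ℝ (Fin 3) | ∀ j, x j ∈ Set.Ico (a j * s) ((a j + 1) * s)}.indicator
        (fun _ => ((Real.sqrt (s ^ 3))⁻¹ : ℂ)) x‖₊ : ℝ≥0∞) ^ 2 = 1 := by
  have hs3 : 0 ≤ s ^ 3 := by positivity
  have hmeas := measurableSet_cell a s
  have hvol := volume_cell a s
  generalize {x : EuclideanSpace ℝ (Fin 3) | ∀ j, x j ∈ Set.Ico (a j * s) ((a j + 1) * s)} = Q
    at hmeas hvol ⊢
  have h1 : (fun x => (‖Q.indicator (fun _ => ((Real.sqrt (s ^ 3))⁻¹ : ℂ)) x‖₊ : ℝ≥0∞) ^ 2)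
      = Q.indicator (fun _ => ENNReal.ofReal ((s ^ 3)⁻¹)) := by
    funext x
    by_cases hx : x ∈ Q
    · simp only [Set.indicator_of_mem hx]
      rw [← ENNReal.coe_pow, ENNReal.ofReal, ENNReal.coe_inj]
      ext
      rw [NNReal.coe_pow, coe_nnnorm, norm_inv, Complex.norm_real,
        Real.norm_of_nonneg (Real.sqrt_nonneg _), inv_pow, Real.sq_sqrt hs3,
        Real.coe_toNNReal _ (by positivity)]
    · simp [hx]
  rw [h1, lintegral_indicator hmeas, setLIntegral_const, hvol,
    ← ENNReal.ofReal_pow hs.le, ← ENNReal.ofReal_mul (by positivity),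
    inv_mul_cancel₀ (by positivity), ENNReal.ofReal_one]

/-- Pigeonhole in `ℝ≥0∞` over a finite nonempty index type: if `A ≤ ∑ i, f i` then some `f i₀`
satisfies `A ≤ card · f i₀`. [folklore] -/
theorem exists_le_card_mul_of_le_sum {ι : Type*} [Fintype ι] [Nonempty ι] (f : ι → ℝ≥0∞)
    {A : ℝ≥0∞} (hA : A ≤ ∑ i, f i) : ∃ i, A ≤ (Fintype.card ι : ℝ≥0∞) * f i := by
  obtain ⟨i, -, hi⟩ := Finset.exists_max_image Finset.univ f Finset.univ_nonempty
  refine ⟨i, hA.trans ?_⟩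
  calc ∑ j, f j ≤ ∑ _j : ι, f i := Finset.sum_le_sum fun j _ => hi j (Finset.mem_univ j)
    _ = (Fintype.card ι : ℝ≥0∞) * f i := by
      rw [Finset.sum_const, Finset.card_univ, nsmul_eq_mul]

end CoarsePigeonhole

open CoarsePigeonhole in
/-- Settles `stmt-AtomisticToContinuum-13036` (exact route decl `CoarsePigeonhole` of
`Theses/BECTangentRigidity.lean`): coarse coherence `∑_Q ⟨φ_Q, γ_Ψ φ_Q⟩ ≥ N/2` over the `8^K`
flat cell modes at a fixed dyadic level `K`, eventually in `N` and uniformly over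
`δ`-near-minimisers, implies `BoseEinsteinCondensation`: by pigeonhole one cell mode has
occupation `≥ N/(2·8^K)`; it is measurable and `L²`-normalised (`L = (N/ρ)^{1/3} > 0` for
`N > 0`), so `occupation_le_maxOccupation` and `le_condensateNumber` give
`HasGroundStateBEC v ρ` with `c = (2·8^K)⁻¹` (Lieb–Seiringer–Solovej–Yngvason 2005, §1.2
(1.17)–(1.19); Penrose–Onsager 1956). [folklore] -/
theorem coarsePigeonhole_proof :
    Summit.AtomisticToContinuum.BoseEinsteinCondensation.Theses.BECTangentRigidity.CoarsePigeonhole := by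
  unfold Summit.AtomisticToContinuum.BoseEinsteinCondensation.Theses.BECTangentRigidity.CoarsePigeonhole
  intro h v hv
  obtain ⟨ρ₀, hρ₀, H⟩ := h v hv
  refine ⟨ρ₀, hρ₀, fun ρ hρ hρlt => ?_⟩
  obtain ⟨K, hev⟩ := H ρ hρ hρlt
  -- the BEC constant `c = (2 · 8^K)⁻¹`
  refine ⟨(2 * ((2 : ℝ) ^ K) ^ 3)⁻¹, by positivity, ?_⟩
  filter_upwards [hev, eventually_gt_atTop 0] with N hN hNpos
  obtain ⟨δ, hδ, hΨ⟩ := hN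
  have hL : 0 < sideLength ρ N := by
    unfold sideLength
    exact Real.rpow_pos_of_pos (div_pos (Nat.cast_pos.mpr hNpos) hρ) _
  have hs : 0 < sideLength ρ N / 2 ^ K := by positivity
  refine le_condensateNumber v hδ fun Ψ hE => ?_
  -- pigeonhole over the `(2^K)^3` cells
  obtain ⟨m, hm⟩ := exists_le_card_mul_of_le_sum _ (hΨ Ψ hE)
  have hcard : (Fintype.card (Fin 3 → Fin (2 ^ K)) : ℝ≥0∞)
      = ENNReal.ofReal (((2 : ℝ) ^ K) ^ 3) := by
    rw [← ENNReal.ofReal_natCast]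
    congr 1
    simp
  have hc0 : (Fintype.card (Fin 3 → Fin (2 ^ K)) : ℝ≥0∞) ≠ 0 := by
    exact_mod_cast Fintype.card_ne_zero
  have hctop : (Fintype.card (Fin 3 → Fin (2 ^ K)) : ℝ≥0∞) ≠ ⊤ := ENNReal.natCast_ne_top _
  -- `card · ofReal (c N) = ofReal (N/2) ≤ card · occ_m`
  have key : (Fintype.card (Fin 3 → Fin (2 ^ K)) : ℝ≥0∞)
      * ENNReal.ofReal ((2 * ((2 : ℝ) ^ K) ^ 3)⁻¹ * N) ≤
      (Fintype.card (Fin 3 → Fin (2 ^ K)) : ℝ≥0∞) *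
        occupation N (({x : EuclideanSpace ℝ (Fin 3) | ∀ j, x j ∈
          Set.Ico ((((m j : ℕ) : ℝ)) * (sideLength ρ N / 2 ^ K))
            ((((m j : ℕ) : ℝ) + 1) * (sideLength ρ N / 2 ^ K))}).indicator
          (fun _ => ((Real.sqrt ((sideLength ρ N / 2 ^ K) ^ 3))⁻¹ : ℂ))) Ψ.ψ := by
    refine le_trans (le_of_eq ?_) hm
    rw [hcard, ← ENNReal.ofReal_mul (by positivity)]
    congr 1
    field_simp
  have hocc := (ENNReal.mul_le_mul_iff_right hc0 hctop).1 key
  exact hocc.trans (occupation_le_maxOccupation _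
    (aestronglyMeasurable_cellMode (fun j => ((m j : ℕ) : ℝ)) _)
    (lintegral_cellMode_sq (fun j => ((m j : ℕ) : ℝ)) hs))

end Summit.AtomisticToContinuum.BoseEinsteinCondensation.Theorems

end
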